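import Summits.ResolutionOfSingularities.ResolutionOfSingularities.Theorems.HilbertSamuelEliminationSigmaMaxModificationsCorridor3WLadderIsoTailsBaseChangeHSFunSpec
import Mathlib.AlgebraicGeometry.PullbackCarrier
import Mathlib.AlgebraicGeometry.Morphisms.FiniteType
import HarnessLib

/-!
# [OURS · L1 W4.2] K2-sep ROUTE A, brick (δ1): **`H_{X ×_k K}(x′) = H_X(pr x′)` AT EVERY POINT of the ground-field base change of a scheme
# locally of finite type over `k` along a SEPARABLE algebraic `K/k`** (globalisation of the affine statement `hsFun_spec_tensorProduct_eq`
# on affine charts: `pullbackSpecIso`, open immersions preserve `H`)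
# (crux `SigmaMaxModifications` stmt-ResolutionOfSingularities-18506 / conjunct stmt-…-19249; line `w_ladder_rows` v8.5, registered stub
# `stub_isoSepRecurrent`; res-L1-w42-plan-1 WORD 2026-08-27T16:25:47Z; design `L/res-L1-w42-stub-2/k2sep/K2SEP-DESIGN.md` §6–7)

Prover res-L1-w42-stub-2 (gen 5). Helper file `--supports stmt-ResolutionOfSingularities-19249 --as helper`; no definitions, no named fact. OURS
(cell res-hironaka, slot W4.2); NOT statements of [Hironaka2017] nor of [CossartJannsenSaito2020]. AI-written; AI review is weaker than expert
review. With (β3) `hsMaxLocus_eq_preimage_of_hsFun_eq` / `isIsolatedInHSMaxLocus_of_hsFun_eq` / `isMaximalOrigin_of_hsFun_eq` this transfers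
the Hilbert–Samuel locus, isolation and maximal origins to `X ×_k K`.

* `hsFun_pullback_SpecMap_algebraMap_eq_of_chart` (a given affine chart) and **`hsFun_pullback_SpecMap_algebraMap_eq`** — for
  `f : X → Spec k` locally of finite type, `K/k` separable algebraic and every point `x′` of
  `X ×_k K = pullback f (Spec K → Spec k)`: `H^N_{X ×_k K}(x′) = H^N_X(pr₁ x′)`.

[OURS · L1 W4.2; AI-written] [cite: CossartJannsenSaito2020, Def. 2.28, Lemma 2.27 (1)] [cite: GortzWedhorn2020, Prop. 5.38]
-/

set_option linter.dupNamespace false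

noncomputable section

open scoped TensorProduct
open CategoryTheory CategoryTheory.Limits AlgebraicGeometry IsLocalRing
open Literature.RingTheory.HilbertSamuel Literature.AlgebraicGeometry.Resolution

namespace Summit.ResolutionOfSingularities.ResolutionOfSingularities.Theorems.SigmaMaxModificationsCorridor3.IsoTailsHS

universe u

set_option maxHeartbeats 800000 in
-- pullback bookkeeping over an affine chart
/-- **`H^N_{X ×_k K}(x′) = H^N_X(pr₁ x′)` — on a given affine chart** `c : Spec R ↪ X` through `pr₁ x′` (open immersion): `Spec R ×_k K ≅
Spec(R ⊗ₖ K)` is an open subscheme of `X ×_k K` through `x′` (`pullbackSpecIso`, `Scheme.Pullback.range_map`), open immersions preserve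
`H`, and on `Spec(R ⊗ₖ K) → Spec R` the statement is `hsFun_spec_tensorProduct_eq`.
[cite: CossartJannsenSaito2020, Def. 2.28, Lemma 2.27 (1)] [cite: GortzWedhorn2020, Prop. 5.38] -/
theorem hsFun_pullback_SpecMap_algebraMap_eq_of_chart {k K : Type u} [Field k] [Field K] [Algebra k K] [Algebra.IsSeparable k K]
    {X : Scheme.{u}} (f : X ⟶ Spec (CommRingCat.of k)) [IsLocallyNoetherian X]
    [IsLocallyNoetherian (pullback f (Spec.map (CommRingCat.ofHom (algebraMap k K))))] (N : ℕ)
    (x' : ↥(pullback f (Spec.map (CommRingCat.ofHom (algebraMap k K)))))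
    {R : CommRingCat.{u}} (c : Spec R ⟶ X) [IsOpenImmersion c] [LocallyOfFiniteType (c ≫ f)] (y : ↥(Spec R))
    (hy : c.base y = (pullback.fst f (Spec.map (CommRingCat.ofHom (algebraMap k K)))).base x') :
    Scheme.hsFun (pullback f (Spec.map (CommRingCat.ofHom (algebraMap k K)))) N x' =
      Scheme.hsFun X N ((pullback.fst f (Spec.map (CommRingCat.ofHom (algebraMap k K)))).base x') := by
  -- the chart `Spec R → X → Spec k` comes from a ring map `k → R`
  obtain ⟨ψ, hψ⟩ : ∃ ψ : CommRingCat.of k ⟶ R, Spec.map ψ = c ≫ f := ⟨Spec.preimage (c ≫ f), Spec.map_preimage _⟩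
  letI : Algebra k R := ψ.hom.toAlgebra
  have hψ' : CommRingCat.ofHom (algebraMap k R) = ψ := rfl
  -- finite type and noetherianity
  haveI : LocallyOfFiniteType (Spec.map ψ) := by rw [hψ]; infer_instance
  haveI : Algebra.FiniteType k R :=
    (HasRingHomProperty.Spec_iff (P := @LocallyOfFiniteType)).mp (inferInstance : LocallyOfFiniteType (Spec.map ψ))
  haveI : IsNoetherianRing R := Algebra.FiniteType.isNoetherianRing k R
  haveI : IsNoetherianRing (R ⊗[k] K) := by
    letI : Algebra K (R ⊗[k] K) := Algebra.TensorProduct.rightAlgebra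
    haveI : Algebra.FiniteType K (R ⊗[k] K) := finiteType_tensorProduct_right
    exact Algebra.FiniteType.isNoetherianRing K (R ⊗[k] K)
  -- the open immersion of the chart's base change into `X ×_k K`
  have e₁ : Spec.map (CommRingCat.ofHom (algebraMap k R)) ≫ 𝟙 (Spec (CommRingCat.of k)) = c ≫ f := by
    rw [Category.comp_id, hψ', hψ]
  have e₂ : Spec.map (CommRingCat.ofHom (algebraMap k K)) ≫ 𝟙 (Spec (CommRingCat.of k)) =
      𝟙 _ ≫ Spec.map (CommRingCat.ofHom (algebraMap k K)) := by rw [Category.comp_id, Category.id_comp]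
  haveI : IsOpenImmersion (pullback.map (Spec.map (CommRingCat.ofHom (algebraMap k R))) (Spec.map (CommRingCat.ofHom (algebraMap k K)))
      f (Spec.map (CommRingCat.ofHom (algebraMap k K))) c (𝟙 _) (𝟙 _) e₁ e₂) := inferInstance
  -- `x′` lies in its image
  have hx'mem : x' ∈ Set.range (pullback.map (Spec.map (CommRingCat.ofHom (algebraMap k R)))
      (Spec.map (CommRingCat.ofHom (algebraMap k K))) f (Spec.map (CommRingCat.ofHom (algebraMap k K))) c (𝟙 _) (𝟙 _) e₁ e₂).base := by
    have hr := Scheme.Pullback.range_map (Spec.map (CommRingCat.ofHom (algebraMap k R)))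
      (Spec.map (CommRingCat.ofHom (algebraMap k K))) f (Spec.map (CommRingCat.ofHom (algebraMap k K))) c (𝟙 _) (𝟙 _) e₁ e₂
    change x' ∈ Set.range ⇑(ConcreteCategory.hom (pullback.map _ _ _ _ _ _ _ e₁ e₂).base)
    rw [hr]
    refine ⟨⟨y, hy⟩, ?_⟩
    show (pullback.snd f _).base x' ∈ Set.range (𝟙 (Spec (CommRingCat.of K)) : Spec _ ⟶ Spec _).base
    exact ⟨(pullback.snd f (Spec.map (CommRingCat.ofHom (algebraMap k K)))).base x', by simp⟩
  obtain ⟨y', hy'⟩ := hx'mem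
  -- (1) along the open immersion into `X ×_k K`
  rw [← hy', ← Scheme.hsFun_eq_of_isOpenImmersion (pullback.map _ _ _ _ _ _ _ e₁ e₂) N y']
  -- (2) along the iso with `Spec (R ⊗ K)`
  rw [Scheme.hsFun_eq_of_isOpenImmersion (pullbackSpecIso k R K).hom N y']
  -- (3) the affine statement
  rw [hsFun_spec_tensorProduct_eq (k := k) (A := R) N ((pullbackSpecIso k R K).hom.base y')]
  -- (4) back to `X` along the chart
  have hpt : (⟨((pullbackSpecIso k R K).hom.base y').asIdeal.under R,
        Ideal.IsPrime.under R ((pullbackSpecIso k R K).hom.base y').asIdeal⟩ : ↥(Spec R)) =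
      (pullback.fst (Spec.map (CommRingCat.ofHom (algebraMap k R))) (Spec.map (CommRingCat.ofHom (algebraMap k K)))).base y' := by
    have h := pullbackSpecIso_hom_fst' k R K
    rw [← h, Scheme.Hom.comp_apply]
    rfl
  change Scheme.hsFun (Spec R) N _ = _
  rw [Scheme.hsFun_eq_of_isOpenImmersion c N, hpt]
  congr 1
  -- `c (pr₁ y′) = pr₁ (i y′)`
  have hcomm : pullback.fst (Spec.map (CommRingCat.ofHom (algebraMap k R))) (Spec.map (CommRingCat.ofHom (algebraMap k K))) ≫ c =
      pullback.map _ _ _ _ _ _ _ e₁ e₂ ≫ pullback.fst f (Spec.map (CommRingCat.ofHom (algebraMap k K))) := by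
    simp only [pullback.lift_fst, pullback.map]
  rw [← Scheme.Hom.comp_apply, hcomm, Scheme.Hom.comp_apply]

/-- **`H^N_{X ×_k K}(x′) = H^N_X(pr₁ x′)` AT EVERY POINT**, for `f : X → Spec k` locally of finite type and `K/k` separable algebraic of any
degree (an affine chart of `X` through `pr₁ x′` and `hsFun_pullback_SpecMap_algebraMap_eq_of_chart`).
[cite: CossartJannsenSaito2020, Def. 2.28, Lemma 2.27 (1)] [cite: GortzWedhorn2020, Prop. 5.38] -/
theorem hsFun_pullback_SpecMap_algebraMap_eq {k K : Type u} [Field k] [Field K] [Algebra k K] [Algebra.IsSeparable k K]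
    {X : Scheme.{u}} (f : X ⟶ Spec (CommRingCat.of k)) [LocallyOfFiniteType f] [IsLocallyNoetherian X]
    [IsLocallyNoetherian (pullback f (Spec.map (CommRingCat.ofHom (algebraMap k K))))] (N : ℕ)
    (x' : ↥(pullback f (Spec.map (CommRingCat.ofHom (algebraMap k K))))) :
    Scheme.hsFun (pullback f (Spec.map (CommRingCat.ofHom (algebraMap k K)))) N x' =
      Scheme.hsFun X N ((pullback.fst f (Spec.map (CommRingCat.ofHom (algebraMap k K)))).base x') := by
  obtain ⟨y, hy⟩ := X.affineOpenCover.covers ((pullback.fst f (Spec.map (CommRingCat.ofHom (algebraMap k K)))).base x')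
  exact hsFun_pullback_SpecMap_algebraMap_eq_of_chart f N x' (X.affineOpenCover.f _) y hy

end Summit.ResolutionOfSingularities.ResolutionOfSingularities.Theorems.SigmaMaxModificationsCorridor3.IsoTailsHS

end
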